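import Summits.QuantumFields.BalabanUV.Beta.GAN24.HessianGaugeLegContact
import Summits.QuantumFields.BalabanUV.Beta.GAN24.ContactLambdaCommutator
import Summits.QuantumFields.BalabanUV.Beta.GAN24.PiBmConstants
import Summits.QuantumFields.BalabanUV.Beta.GAN24.TransversalZeroMode

/-!
# `BalabanUV.Beta.GAN24.HessianTablePlainCharge` — binder row G-an2-4 ∕ (CONV-C), CT-W «WC-TL» → «QR-LL», the (S) row of RULING R-gan24p1-g27-1, the plain sub-row of
# (W-γ), MULTIPLIER HALF: **THE PLAIN PAIR CHARGE OF an1's ROOTED CONSTRAINT-HESSIAN TABLE `hessFFAt ρ L μ w` (the letter of `M1At`) IN CLOSED FORM — IT VANISHES AT THE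
# CENTRED ROOT AND ONLY THERE** (road-P2 chair `b2b-balaban-gan24-p2`, gen 40, INTENT 4; the `M1` half of the plain charge that (T-F) `WardResidualFieldTotals` leaves displayed)

NOT IN PRINT; OUR BOOKKEEPING ([folklore] BY NAME over leaf-02 g47's fluctuation-slot law `HessianGaugeLegContact.tsum_dz_mul_hessFFAt` read at the COORDINATE potential `ψ = x_a`
(`dz x_a = 1_a`, the flat mode), leaf-01's pairing `ContactLambdaCommutator.tsum_sum_mul_gaugeWeight_mul_linKerAt` ∕ `tsum_sum_linKerAt_mul_eq_contourSum_sub`, node 5ρ's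
`linAvgAt_grad` ∕ `LamAt_add` ∕ `axial_sum_grad`, and two box counts; 0 `def`, 0 cited fact, 0 `def … : Prop`, 0 sorry).  HONEST FRAMING (cell contract, verbatim):
«discharging `BetaPertH` makes Bałaban's UV stability UNCONDITIONAL — a real constructive-QFT result; it is NOT the continuum limit and NOT the Clay problem.»  HONEST DEPENDENCY
(verbatim): «continuum YM on T⁴ ⇐ BetaPertH ∧ nine spine estimates (0/9 proved); BetaPertH ⇐ (D1) ∧ (D4) ∧ CAP+tail; G-an2-4 gates asym, D1 and NE2/3/4.»

WHAT (`d + 1` dimensions, `L ≥ 1`, in-block root `ρ = toSite r`; `H_b = hessFFAt ρ L μ w`, the field–field letter of `M1At … μ w = (cΛ·wM1_j) • H_b`; `q¹_b = linKerAt ρ L μ w`).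
* §1 `dz_coord` (`dz x_a κ x = 𝟙[a = κ]`), **`tsum_hessFFAt_inl_inl`**: `Σ'_x H_b x x′ (inl a)(inl b′) = (x′_a + ½𝟙[b′ = a] − r_a − ½L𝟙[μ = a])·q¹_b(b′, x′)`, `r = L•w + ρ` (leaf-02's `dψ`-law at `ψ = x_a`).
* §2 **`tsum_tsum_hessFFAt_inl_inl`**: the PLAIN pair charge `Z_{ab′}(H_b) := Σ'_{x′} Σ'_x H_b x x′ (inl a)(inl b′) = (2L^{d+1})⁻¹·(linAvgAt ρ G_{ab′} L μ w − (2r_a + L𝟙[μ = a])·linAvgAt ρ 1_{b′} L μ w)`,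
  `G_{ab′} α x := (x_a + (x + e_α)_a)·𝟙[α = b′]` (leaf-01's pairing).
* §3 the two rooted averagings evaluated: `indicator_eq_grad`, `linAvgAt_indicator` (`linAvgAt ρ 1_{b′} L μ w = L^{d+1}·L·𝟙[b′ = μ]`, `1_{b′} = grad x_{b′}`), `LamAt_sub`,
  `contourSum_G` (gan24-p4's `PiBmConstants.sum_box_coord`, leaf-02 g5x's `TransversalZeroMode.card_box_succ`), `shift_G_sub_eq_grad`, `LamAt_G_step`, **`linAvgAt_G`**.
* §4 **`plainCharge_hessFFAt_eq`**: `Z_{ab′}(hessFFAt (toSite r) L μ w) = 𝟙[b′ = μ]·𝟙[a ≠ μ]·L·((L−1)/2 − r_a) − 𝟙[a = μ]·𝟙[b′ ≠ μ]·L·((L−1)/2 − r_{b′})` (antisymmetric, `w`-free), and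
  **`plainCharge_hessFFAt_eq_zero_of_centred`**: at the CENTRED root (`2·r_c + 1 = L` for all `c`, `L` odd) every plain pair charge of every `H_b` VANISHES — so the `M1` half of the
  plain (γ)∕(α⁺) charges drops out of (W-γ)'s plain sub-row (E26g) exactly when the root is Bałaban's centre; `plainCharge_hessFFAt_corner`: at a corner root (`r = 0`, `L ≥ 2`)
  `Z_{aμ} = L(L−1)/2 ≠ 0` (`a ≠ μ`) — the centring is load-bearing.
Asserts NO value of Bałaban's tables beyond their typed letters; discharges NOTHING of (S) ∕ (Q-R) ∕ (LT) ∕ (Q-L) ∕ (C) ∕ «T2Shape» ∕ «T2Drift» ∕ (hW, hWall); NEVER «G-an2-4 closed» as (CONV-C);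
NOT D1, NOT BetaPertH, NOT continuum, NOT Clay.  2026-08-22; no existing file touched.
-/

noncomputable section

open Finset
open scoped BigOperators
open Literature.MathematicalPhysics.QuantumFieldTheory.Balaban1983to89
open Literature.MathematicalPhysics.QuantumFieldTheory.Balaban1983to89.Beta
open AffineAveraging (box toSite dz unitVec contourSum)
open Summit.QuantumFields.BalabanUV.Beta.GAN24.PiBmConstants (sum_box_coord)
open Summit.QuantumFields.BalabanUV.Beta.GAN24.TransversalZeroMode (card_box_succ)
open AveragingContours (grad shift axial axial_sum_grad axial_sum_sub)
open AveragingContoursRooted (linAvgAt LamAt linAvgAt_grad LamAt_add linAvgAt_eq_contourSum_sub_dz linAvgAt_sub)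
open AveragingHessianKernelsRooted (hessFFAt linKerAt)
open Summit.QuantumFields.BalabanUV.Beta.GAN24.HessianGaugeLegContact (tsum_dz_mul_hessFFAt)
open Summit.QuantumFields.BalabanUV.Beta.GAN24.ContactLambdaCommutator (tsum_sum_mul_gaugeWeight_mul_linKerAt)

namespace Summit.QuantumFields.BalabanUV.Beta.GAN24.HessianTablePlainCharge

variable {d : ℕ}

/-! ## §1 One fluctuation leg summed against the flat mode `1_a = dz x_a` -/

/-- [folklore] The flat mode is exact with the coordinate as potential: `dz x_a κ x = 𝟙[κ = a]`. -/
theorem dz_coord (a κ : Fin (d + 1)) (x : Fin (d + 1) → ℤ) :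
    dz (fun z : Fin (d + 1) → ℤ => ((z a : ℤ) : ℝ)) κ x = if a = κ then (1 : ℝ) else 0 := by
  simp only [AffineAveraging.dz, Pi.add_apply, AffineAveraging.unitVec, Pi.single_apply, Int.cast_add, Int.cast_ite, Int.cast_one,
    Int.cast_zero]
  ring

/-- NOT IN PRINT; OUR BOOKKEEPING.  **ONE FLUCTUATION LEG OF `H_b` SUMMED** (leaf-02 g47's `tsum_dz_mul_hessFFAt` at the coordinate potential `ψ = x_a`): for the coarse bond
`b = (μ, w)` with root `r = L•w + ρ`, `Σ'_x H_b x x′ (inl a)(inl b′) = (x′_a + ½𝟙[b′ = a] − r_a − ½L𝟙[μ = a])·q¹_b(b′, x′)`. -/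
theorem tsum_hessFFAt_inl_inl {L : ℕ} (hL : 1 ≤ L) {r : Fin (d + 1) → ℕ} (hr : r ∈ box (d + 1) L) (μ : Fin (d + 1)) (w x' : Fin (d + 1) → ℤ)
    (a b' : Fin (d + 1)) :
    ∑' x, hessFFAt (toSite r) L μ w x x' (Sum.inl a) (Sum.inl b')
      = (((x' a : ℤ) : ℝ) + (if a = b' then (1 : ℝ) else 0) / 2 - ((((L : ℤ) • w + toSite r) a : ℤ) : ℝ) - (if a = μ then (L : ℝ) else 0) / 2)
        * linKerAt (toSite r) L μ w (b', x') := by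
  have h := tsum_dz_mul_hessFFAt hL hr μ w x' b' (fun z : Fin (d + 1) → ℤ => ((z a : ℤ) : ℝ))
  simp only [dz_coord, ite_mul, one_mul, zero_mul, Finset.sum_ite_eq, Finset.mem_univ, if_true] at h
  rw [h]
  have e1 : (((x' + unitVec b') a : ℤ) : ℝ) = ((x' a : ℤ) : ℝ) + (if a = b' then (1 : ℝ) else 0) := by
    simp only [Pi.add_apply, AffineAveraging.unitVec, Pi.single_apply, Int.cast_add, Int.cast_ite, Int.cast_one, Int.cast_zero]
  have e2 : ((((L : ℤ) • w + toSite r + (L : ℤ) • unitVec μ) a : ℤ) : ℝ) = ((((L : ℤ) • w + toSite r) a : ℤ) : ℝ) + (if a = μ then (L : ℝ) else 0) := by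
    simp only [Pi.add_apply, Pi.smul_apply, AffineAveraging.unitVec, Pi.single_apply, smul_eq_mul, mul_ite, mul_one, mul_zero, Int.cast_add,
      Int.cast_ite, Int.cast_natCast, Int.cast_zero]
  rw [e1, e2]
  ring

/-! ## §2 The plain pair charge through leaf-01's pairing -/

/-- NOT IN PRINT; OUR BOOKKEEPING.  **THE PLAIN PAIR CHARGE OF `H_b` AS TWO ROOTED AVERAGINGS** (leaf-02's `dψ`-law at `ψ = x_a`, then leaf-01's
`tsum_sum_mul_gaugeWeight_mul_linKerAt` with the indicator form `1_{b′}`): `Z_{ab′}(H_b) := Σ'_{x′} Σ'_x H_b x x′ (inl a)(inl b′)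
= (2L^{d+1})⁻¹·(linAvgAt ρ G_{ab′} L μ w − (r_a + (r + L•e_μ)_a)·linAvgAt ρ 1_{b′} L μ w)`, `G_{ab′} α x = (x_a + (x+e_α)_a)·𝟙[α = b′]`, `r = L•w + ρ`. -/
theorem tsum_tsum_hessFFAt_inl_inl {L : ℕ} (hL : 1 ≤ L) {r : Fin (d + 1) → ℕ} (hr : r ∈ box (d + 1) L) (μ : Fin (d + 1)) (w : Fin (d + 1) → ℤ) (a b' : Fin (d + 1)) :
    ∑' x', ∑' x, hessFFAt (toSite r) L μ w x x' (Sum.inl a) (Sum.inl b')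
      = (2 * (L : ℝ) ^ (d + 1))⁻¹ *
          (linAvgAt (toSite r) (fun α x => ((((x a : ℤ) : ℝ)) + (((x + unitVec α) a : ℤ) : ℝ)) * (if α = b' then (1 : ℝ) else 0)) L μ w
            - (((((L : ℤ) • w + toSite r) a : ℤ) : ℝ) + ((((L : ℤ) • w + toSite r + (L : ℤ) • unitVec μ) a : ℤ) : ℝ))
              * linAvgAt (toSite r) (fun α _ => if α = b' then (1 : ℝ) else 0) L μ w) := by
  have e : ∀ x' : Fin (d + 1) → ℤ, ∑' x, hessFFAt (toSite r) L μ w x x' (Sum.inl a) (Sum.inl b')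
      = ∑ α, (if α = b' then (1 : ℝ) else 0) *
          (((((x' a : ℤ) : ℝ)) + (((x' + unitVec α) a : ℤ) : ℝ) - ((((L : ℤ) • w + toSite r) a : ℤ) : ℝ) - ((((L : ℤ) • w + toSite r + (L : ℤ) • unitVec μ) a : ℤ) : ℝ))
            * linKerAt (toSite r) L μ w (α, x') / 2) := fun x' => by
    have h := tsum_dz_mul_hessFFAt hL hr μ w x' b' (fun z : Fin (d + 1) → ℤ => ((z a : ℤ) : ℝ))
    simp only [dz_coord, ite_mul, one_mul, zero_mul, Finset.sum_ite_eq, Finset.mem_univ, if_true] at h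
    rw [h]
    simp only [ite_mul, one_mul, zero_mul, Finset.sum_ite_eq', Finset.mem_univ, if_true]
  rw [tsum_congr e, tsum_sum_mul_gaugeWeight_mul_linKerAt hr (fun z : Fin (d + 1) → ℤ => ((z a : ℤ) : ℝ)) (fun α _ => if α = b' then (1 : ℝ) else 0) μ w]

/-! ## §3 The two rooted averagings evaluated -/

/-- [folklore] The indicator form of direction `b′` is exact with the coordinate as potential: `1_{b′} = grad x_{b′}`. -/
theorem indicator_eq_grad (b' : Fin (d + 1)) :
    (fun (α : Fin (d + 1)) (_ : Fin (d + 1) → ℤ) => if α = b' then (1 : ℝ) else 0) = grad (fun z : Fin (d + 1) → ℤ => ((z b' : ℤ) : ℝ)) := by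
  funext α x
  simp only [grad, Pi.add_apply, AffineAveraging.unitVec, Pi.single_apply, Int.cast_add, Int.cast_ite, Int.cast_one, Int.cast_zero]
  by_cases h : α = b'
  · subst h; simp
  · rw [if_neg h, if_neg (Ne.symm h)]; ring

/-- NOT IN PRINT; OUR BOOKKEEPING.  **THE ROOTED AVERAGING OF THE INDICATOR FORM**: `linAvgAt ρ 1_{b′} L μ w = L^{d+1}·L·𝟙[b′ = μ]` (node 5ρ's `linAvgAt_grad`: the contours of the coarse
bond `(μ, w)` advance by `L` in direction `μ` and by `0` in every other direction). -/
theorem linAvgAt_indicator (ρ : Fin (d + 1) → ℤ) (L : ℕ) (μ : Fin (d + 1)) (w : Fin (d + 1) → ℤ) (b' : Fin (d + 1)) :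
    linAvgAt ρ (fun (α : Fin (d + 1)) (_ : Fin (d + 1) → ℤ) => if α = b' then (1 : ℝ) else 0) L μ w = (L : ℝ) ^ (d + 1) * (if b' = μ then (L : ℝ) else 0) := by
  rw [indicator_eq_grad, linAvgAt_grad, card_box_succ, nsmul_eq_mul]
  simp only [Pi.add_apply, Pi.smul_apply, AffineAveraging.unitVec, Pi.single_apply, smul_eq_mul, mul_ite, mul_one, mul_zero, Int.cast_add, Int.cast_mul,
    Int.cast_ite, Int.cast_natCast, Int.cast_zero, Nat.cast_pow]
  split_ifs <;> ring

/-- [folklore] The rooted block axial potential is linear in the form (differences). -/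
theorem LamAt_sub (ρ : Fin (d + 1) → ℤ) (A A' : Fin (d + 1) → (Fin (d + 1) → ℤ) → ℝ) (L : ℕ) (y : Fin (d + 1) → ℤ) :
    LamAt ρ (A - A') L y = LamAt ρ A L y - LamAt ρ A' L y := by
  unfold LamAt
  rw [← Finset.sum_sub_distrib]
  exact Finset.sum_congr rfl fun b _ => axial_sum_sub A A' _ _

/-- NOT IN PRINT; OUR BOOKKEEPING.  **THE STRAIGHT-CONTOUR SUM OF `G_{ab′}`**: `contourSum L G_{ab′} μ w = 𝟙[μ = b′]·L^{d+2}·(2L·w_a + (L − 1) + 𝟙[a = μ]·L)` (the `L` sites of each straight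
contour, the arithmetic sum over the box `PiBmConstants.sum_box_coord`, and `Σ_{s<L}(2s+1) = L²`). -/
theorem contourSum_G {L : ℕ} (hL : 1 ≤ L) (μ : Fin (d + 1)) (w : Fin (d + 1) → ℤ) (a b' : Fin (d + 1)) :
    contourSum L (fun α x => ((((x a : ℤ) : ℝ)) + (((x + unitVec α) a : ℤ) : ℝ)) * (if α = b' then (1 : ℝ) else 0)) μ w
      = if μ = b' then (L : ℝ) ^ (d + 2) * (2 * (L : ℝ) * (w a : ℝ) + ((L : ℝ) - 1) + (if a = μ then (L : ℝ) else 0)) else 0 := by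
  by_cases hμ : μ = b'
  · rw [if_pos hμ]
    simp only [contourSum, if_pos hμ, mul_one]
    have e : ∀ (v : Fin (d + 1) → ℕ) (s : ℕ), ((((((L : ℤ) • w + toSite v + (s : ℤ) • unitVec μ) a : ℤ) : ℝ))
          + (((((L : ℤ) • w + toSite v + (s : ℤ) • unitVec μ + unitVec μ) a : ℤ) : ℝ)))
        = (2 * ((L : ℝ) * (w a : ℝ)) + 2 * ((v a : ℕ) : ℝ)) + ((2 * (s : ℝ) + 1) * (if a = μ then (1 : ℝ) else 0)) := fun v s => by
      simp only [Pi.add_apply, Pi.smul_apply, AffineAveraging.unitVec, Pi.single_apply, smul_eq_mul, toSite, mul_ite, mul_one, mul_zero, Int.cast_add,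
        Int.cast_mul, Int.cast_ite, Int.cast_natCast, Int.cast_zero, Int.cast_one]
      split_ifs <;> ring
    simp only [e, Finset.sum_add_distrib, Finset.sum_const, Finset.card_range, nsmul_eq_mul, card_box_succ]
    have hs : ∑ s ∈ Finset.range L, ((2 * (s : ℝ) + 1) * (if a = μ then (1 : ℝ) else 0)) = (L : ℝ) ^ 2 * (if a = μ then (1 : ℝ) else 0) := by
      rw [← Finset.sum_mul]
      congr 1
      have h2 : ∑ s ∈ Finset.range L, (2 * (s : ℝ) + 1) = 2 * (∑ s ∈ Finset.range L, (s : ℝ)) + L := by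
        rw [Finset.sum_add_distrib, Finset.sum_const, Finset.card_range, ← Finset.mul_sum]; simp
      rw [h2, ← Nat.cast_sum, ← Nat.cast_ofNat, ← Nat.cast_mul, mul_comm, Finset.sum_range_id_mul_two]
      rcases Nat.exists_eq_succ_of_ne_zero (by omega : L ≠ 0) with ⟨k, rfl⟩
      push_cast; ring
    rw [hs, ← Finset.mul_sum, ← Finset.mul_sum, sum_box_coord hL a]
    push_cast
    split_ifs <;> ring
  · rw [if_neg hμ]
    simp only [contourSum, if_neg hμ, mul_zero, Finset.sum_const_zero]

/-- [folklore] Translating `G_{ab′}` by the coarse bond `L•e_μ` adds the EXACT form `grad (2L·𝟙[a = μ]·x_{b′})`. -/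
theorem shift_G_sub_eq_grad (L : ℕ) (μ a b' : Fin (d + 1)) :
    (shift ((L : ℤ) • unitVec μ) (fun α x => ((((x a : ℤ) : ℝ)) + (((x + unitVec α) a : ℤ) : ℝ)) * (if α = b' then (1 : ℝ) else 0))
        - fun α x => ((((x a : ℤ) : ℝ)) + (((x + unitVec α) a : ℤ) : ℝ)) * (if α = b' then (1 : ℝ) else 0))
      = grad (fun z : Fin (d + 1) → ℤ => (2 * (L : ℝ) * (if a = μ then (1 : ℝ) else 0)) * ((z b' : ℤ) : ℝ)) := by
  funext α x
  by_cases h1 : α = b'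
  · subst h1
    simp only [Pi.sub_apply, shift, grad, Pi.add_apply, Pi.smul_apply, AffineAveraging.unitVec, Pi.single_eq_same, Pi.single_apply, smul_eq_mul,
      if_true, mul_one]
    push_cast
    split_ifs <;> ring
  · have h3 : ¬ b' = α := fun h => h1 h.symm
    simp only [Pi.sub_apply, shift, grad, Pi.add_apply, AffineAveraging.unitVec, Pi.single_apply, if_neg h1, if_neg h3, mul_zero, sub_self,
      add_zero, Int.cast_add]

/-- NOT IN PRINT; OUR BOOKKEEPING.  **THE COARSE STEP OF THE ROOTED BLOCK AXIAL POTENTIAL OF `G_{ab′}`**: `Λ^ρ[G_{ab′}](w + e_μ) − Λ^ρ[G_{ab′}](w) = 2L·𝟙[a = μ]·L^{d+1}·((L−1)/2 − r_{b′})`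
(`LamAt_add` + `LamAt_sub` reduce it to the potential of the exact form above; `axial_sum_grad` and the box arithmetic sum). -/
theorem LamAt_G_step {L : ℕ} (hL : 1 ≤ L) (r : Fin (d + 1) → ℕ) (μ : Fin (d + 1)) (w : Fin (d + 1) → ℤ) (a b' : Fin (d + 1)) :
    LamAt (toSite r) (fun α x => ((((x a : ℤ) : ℝ)) + (((x + unitVec α) a : ℤ) : ℝ)) * (if α = b' then (1 : ℝ) else 0)) L (w + unitVec μ)
      - LamAt (toSite r) (fun α x => ((((x a : ℤ) : ℝ)) + (((x + unitVec α) a : ℤ) : ℝ)) * (if α = b' then (1 : ℝ) else 0)) L w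
      = (2 * (L : ℝ) * (if a = μ then (1 : ℝ) else 0)) * ((L : ℝ) ^ (d + 1) * (((L : ℝ) - 1) / 2 - (r b' : ℝ))) := by
  rw [LamAt_add, ← LamAt_sub, shift_G_sub_eq_grad]
  unfold LamAt
  simp only [axial_sum_grad, ← mul_sub, ← Finset.mul_sum]
  congr 1
  simp only [Pi.add_apply, Pi.smul_apply, toSite, smul_eq_mul, Int.cast_add, Int.cast_mul, Int.cast_natCast, add_sub_add_left_eq_sub,
    Finset.sum_sub_distrib, Finset.sum_const, card_box_succ, nsmul_eq_mul, sum_box_coord hL b', Nat.cast_pow]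
  ring

/-- NOT IN PRINT; OUR BOOKKEEPING.  **THE ROOTED AVERAGING OF `G_{ab′}` EVALUATED** (node 5ρ: straight-contour sum minus the coarse step of the block axial potential):
`linAvgAt ρ G_{ab′} L μ w = 𝟙[μ = b′]·L^{d+2}·(2L·w_a + L − 1 + 𝟙[a = μ]·L) − 𝟙[a = μ]·2L·L^{d+1}·((L−1)/2 − r_{b′})`. -/
theorem linAvgAt_G {L : ℕ} (hL : 1 ≤ L) (r : Fin (d + 1) → ℕ) (μ : Fin (d + 1)) (w : Fin (d + 1) → ℤ) (a b' : Fin (d + 1)) :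
    linAvgAt (toSite r) (fun α x => ((((x a : ℤ) : ℝ)) + (((x + unitVec α) a : ℤ) : ℝ)) * (if α = b' then (1 : ℝ) else 0)) L μ w
      = (if μ = b' then (L : ℝ) ^ (d + 2) * (2 * (L : ℝ) * (w a : ℝ) + ((L : ℝ) - 1) + (if a = μ then (L : ℝ) else 0)) else 0)
        - (2 * (L : ℝ) * (if a = μ then (1 : ℝ) else 0)) * ((L : ℝ) ^ (d + 1) * (((L : ℝ) - 1) / 2 - (r b' : ℝ))) := by
  rw [linAvgAt_eq_contourSum_sub_dz, contourSum_G hL, AffineAveraging.dz, LamAt_G_step hL]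

/-! ## §4 The plain pair charge in closed form; the centred root -/

/-- NOT IN PRINT; OUR BOOKKEEPING.  **THE PLAIN PAIR CHARGE OF THE ROOTED CONSTRAINT-HESSIAN TABLE IN CLOSED FORM**: for `L ≥ 1`, an in-block root `ρ = toSite r`, every coarse bond
`(μ, w)` and channel `(a, b′)`,
`Σ'_{x′} Σ'_x hessFFAt ρ L μ w x x′ (inl a)(inl b′) = L·(𝟙[b′ = μ]·((L−1)/2 − r_a) − 𝟙[a = μ]·((L−1)/2 − r_{b′}))` — `w`-free, antisymmetric in `(a, b′)`, and a function of the
root's offsets from the block CENTRE only. -/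
theorem plainCharge_hessFFAt_eq {L : ℕ} (hL : 1 ≤ L) {r : Fin (d + 1) → ℕ} (hr : r ∈ box (d + 1) L) (μ : Fin (d + 1)) (w : Fin (d + 1) → ℤ) (a b' : Fin (d + 1)) :
    ∑' x', ∑' x, hessFFAt (toSite r) L μ w x x' (Sum.inl a) (Sum.inl b')
      = (L : ℝ) * ((if b' = μ then ((L : ℝ) - 1) / 2 - (r a : ℝ) else 0) - (if a = μ then ((L : ℝ) - 1) / 2 - (r b' : ℝ) else 0)) := by
  rw [tsum_tsum_hessFFAt_inl_inl hL hr, linAvgAt_G hL, linAvgAt_indicator]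
  have hLr : (L : ℝ) ≠ 0 := by exact_mod_cast (show L ≠ 0 by omega)
  simp only [Pi.add_apply, Pi.smul_apply, toSite, AffineAveraging.unitVec, Pi.single_apply, smul_eq_mul, mul_ite, mul_one, mul_zero, Int.cast_add, Int.cast_mul,
    Int.cast_ite, Int.cast_natCast, Int.cast_zero]
  by_cases hb : b' = μ
  · subst hb
    by_cases ha : a = b'
    · subst ha; simp only [if_true]; field_simp; ring
    · simp only [ha, if_false, if_true]; field_simp; ring
  · by_cases ha : a = μ
    · subst ha; simp only [hb, if_false, if_true, Ne.symm hb]; field_simp; ring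
    · simp only [ha, hb, if_false, Ne.symm hb]; field_simp; ring

/-- NOT IN PRINT; OUR BOOKKEEPING.  **AT THE CENTRED ROOT EVERY PLAIN PAIR CHARGE OF EVERY `H_b` VANISHES** (`2·r_c + 1 = L` for all `c`, Bałaban's centre of an odd block): the `M1` letter
`(cΛ·wM1_j) • hessFFAt ρ_c L μ w` is charge-free in the plain currency, so the multiplier half of the plain (γ) ∕ (α⁺) charges drops out of (W-γ)'s plain sub-row — at the
centred root, and (by the closed form) only there up to the diagonal channel. -/
theorem plainCharge_hessFFAt_eq_zero_of_centred {L : ℕ} (hL : 1 ≤ L) {r : Fin (d + 1) → ℕ} (hr : r ∈ box (d + 1) L) (hc : ∀ c : Fin (d + 1), 2 * (r c : ℝ) + 1 = L)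
    (μ : Fin (d + 1)) (w : Fin (d + 1) → ℤ) (a b' : Fin (d + 1)) :
    ∑' x', ∑' x, hessFFAt (toSite r) L μ w x x' (Sum.inl a) (Sum.inl b') = 0 := by
  rw [plainCharge_hessFFAt_eq hL hr]
  have ha := hc a
  have hb := hc b'
  have e1 : ((L : ℝ) - 1) / 2 - (r a : ℝ) = 0 := by linarith
  have e2 : ((L : ℝ) - 1) / 2 - (r b' : ℝ) = 0 := by linarith
  rw [e1, e2]
  simp

/-- [folklore] WITNESS that the centring is needed: at the CORNER root `r = 0` and `L ≥ 2`, the channel `(a, μ)`, `a ≠ μ`, carries the charge `L(L−1)/2 ≠ 0`. -/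
theorem plainCharge_hessFFAt_corner {L : ℕ} (hL : 2 ≤ L) {μ a : Fin (d + 1)} (ha : a ≠ μ) (w : Fin (d + 1) → ℤ) :
    ∑' x', ∑' x, hessFFAt (toSite (fun _ : Fin (d + 1) => (0 : ℕ))) L μ w x x' (Sum.inl a) (Sum.inl μ) = (L : ℝ) * (((L : ℝ) - 1) / 2) ∧
      (L : ℝ) * (((L : ℝ) - 1) / 2) ≠ 0 := by
  have hr : (fun _ : Fin (d + 1) => (0 : ℕ)) ∈ box (d + 1) L := Fintype.mem_piFinset.2 fun _ => Finset.mem_range.2 (by omega)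
  refine ⟨?_, ?_⟩
  · rw [plainCharge_hessFFAt_eq (by omega) hr]
    simp [ha]
  · have h1 : (0 : ℝ) < L := by exact_mod_cast (show 0 < L by omega)
    have h2 : (0 : ℝ) < (L : ℝ) - 1 := by
      have : (2 : ℝ) ≤ L := by exact_mod_cast hL
      linarith
    positivity

end Summit.QuantumFields.BalabanUV.Beta.GAN24.HessianTablePlainCharge

end
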